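import Summits.AnomalousDissipation.AnomalousDissipation.Theorems.SoloBlindDriftScreening
import Summits.AnomalousDissipation.AnomalousDissipation.Theorems.SoloBlindReynoldsProduction
import Literature.Analysis.FunctionSpaces.TorusFluidGlueProofs

/-!
# Solo (blind) — the two flux-moment identities of the Kolmogorov-forced steady problem

For the Kolmogorov force `f = cos(2πx₃) e₁` (`kolForce`) and ANY smooth steady Navier–Stokes state
`(U, P)` at viscosity `ν` on `𝕋³` (any momentum `m = ∫ U`), testing the steady equation against the
two shear fields of the forced shell `{±e₃}`,

* `g = sin(2πx₃) e₁` (`kolSin`, the conjugate shear): `∫ U₃ ⟪f, U⟫ = 2πν ∫ ⟪g, U⟫`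
  (`flux_quadrature_identity`) — the momentum-flux moment in quadrature with the force is `O(ν)`;
* `f` itself: `2π ∫ U₃ ⟪g, U⟫ = ½ − 4π²ν ∫⟪f, U⟫` (`flux_inphase_identity`) — the flux moment in
  phase with `∇f` is PINNED to `1/(4π)` up to `O(ν)·(work)`.

Writing `m₃ = ∫ U₃`, `W = ∫⟪f, U⟫ = ν ∫‖∇U‖²` (injected = dissipated power) and the FLUCTUATION
flux moments `Φ_s = ∫ (U₃ − m₃) ⟪g, U⟫`, `Φ_c = ∫ (U₃ − m₃) ⟪f, U⟫`, the two identities combine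
into the exact WORK FORMULA (`work_formula`)

  `W · (m₃² + 4π²ν²) = ν/2 − 2πν Φ_s − m₃ Φ_c`.

Readings. (i) With no fluctuation flux (`Φ_s = Φ_c = 0`) this is the drifted laminar law
`W = (ν/2)/(m₃² + 4π²ν²)` of `SoloBlindDriftScreening` (`→ 0` for `m₃ ≠ 0`, `= 1/(8π²ν)` at
`m₃ = 0`). (ii) At zero momentum `m₃ = 0`: `W = (1/2 − 2πΦ_s)/(4π²ν)`, so a dissipation floor
`0 < ε ≤ W ≤ E` along `ν → 0` is the statement that the in-phase fluctuation flux sits BELOW its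
pinned value `1/(4π)` by exactly `2πν W`: a second-order (defect) statement about a pinned
correlation. (iii) At `m₃ ≠ 0`: `W = −Φ_c/m₃ + O(ν)`, a first-order statement about the
quadrature flux, which at `m₃ = 0` is itself forced to be `O(ν)`. This is the sharpest form we
know of "what a proof of the zeroth law for the Kolmogorov force must do"; it is an identity, not
a bound, and holds verbatim for long-time means of smooth statistically steady solutions.
[folklore; cite: Temam1984, Ch. II §1.2 Lemma 1.3 (antisymmetry of the trilinear form)]
-/

open MeasureTheory Filter Topology Set UnitAddTorus
open scoped ENNReal NNReal ComplexConjugate InnerProductSpace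

noncomputable section

namespace Summit.AnomalousDissipation.AnomalousDissipation.Theorems

open Literature.Analysis.FunctionSpaces Literature.Analysis.FunctionSpaces.Torus
open Literature.Analysis.FluidPDE

/-! ### The conjugate shear `g = sin(2πx₃) e₁` -/

/-- Fourier coefficients of `sin(2πx₃) e₁` on the shell `{±e₃}`: `∓(i/2) e₁ = −i k₃ · (½e₁)`.
[folklore] -/
def kolSinCoeff (k : Fin 3 → ℤ) : EuclideanSpace ℂ (Fin 3) :=
  (-(Complex.I * ((k 2 : ℤ) : ℂ))) • kolVec

/-- The conjugate shear `g(x) = sin(2πx₃) e₁`. [folklore] -/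
def kolSin : UnitAddTorus (Fin 3) → EuclideanSpace ℝ (Fin 3) :=
  realTrigPoly kolModes kolSinCoeff

/-- The coefficients of `g` are conjugate symmetric. [folklore] -/
theorem isConjSymm_kolSinCoeff : IsConjSymm kolSinCoeff := by
  intro k
  rw [kolSinCoeff, kolSinCoeff, EuclideanSpace.conjVec_smul, conjVec_kolVec, map_neg, map_mul,
    Complex.conj_I, map_intCast, Pi.neg_apply, Int.cast_neg]
  congr 1
  ring

/-- The coefficients of `g` are transversal. [folklore] -/
theorem isTransversal_kolSinCoeff : IsTransversal kolModes kolSinCoeff := by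
  intro k hk
  simp [kolSinCoeff, Fin.sum_univ_three, apply_zero_of_mem_kolModes hk, kolVec_apply_one,
    kolVec_apply_two]

/-- `g` is smooth. [folklore] -/
theorem isSmooth_kolSin : IsSmooth kolSin := isSmooth_realTrigPoly _ _

/-- `g` is divergence free. [folklore] -/
theorem isDivFree_kolSin : IsDivFree kolSin := isDivFree_realTrigPoly isTransversal_kolSinCoeff

/-- `(k₃)² = 1` on the shell, complex form. [folklore] -/
theorem sq_apply_two_of_mem_kolModes_complex {k : Fin 3 → ℤ} (hk : k ∈ kolModes) :
    ((k 2 : ℤ) : ℂ) ^ 2 = 1 := by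
  exact_mod_cast sq_apply_two_of_mem_kolModes hk

/-- `Δg = −4π² g`. [folklore] -/
theorem laplacian_kolSin (y : UnitAddTorus (Fin 3)) :
    Torus.laplacian kolSin y = (-(4 * Real.pi ^ 2)) • kolSin y := by
  rw [kolSin, laplacian_realTrigPoly, smul_realTrigPoly_apply]
  exact congrFun (realTrigPoly_congr fun k hk => by
    rw [freqNormSq_of_mem_kolModes hk, Pi.smul_apply, ← Complex.coe_smul, ← neg_smul]
    congr 1
    push_cast
    ring) y

/-- `Δf = −4π² f`. [folklore] -/
theorem laplacian_kolForce (y : UnitAddTorus (Fin 3)) :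
    Torus.laplacian kolForce y = (-(4 * Real.pi ^ 2)) • kolForce y := by
  rw [kolForce, laplacian_realTrigPoly, smul_realTrigPoly_apply]
  exact congrFun (realTrigPoly_congr fun k hk => by
    rw [freqNormSq_of_mem_kolModes hk, Pi.smul_apply, ← Complex.coe_smul, ← neg_smul]
    congr 1
    push_cast
    ring) y

/-- `∂₁ g = 0`. [folklore] -/
theorem partialDeriv_zero_kolSin (y : UnitAddTorus (Fin 3)) : partialDeriv 0 kolSin y = 0 := by
  rw [kolSin, partialDeriv_realTrigPoly,
    realTrigPoly_congr (c' := 0) fun k hk => by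
      rw [apply_zero_of_mem_kolModes hk, Int.cast_zero, mul_zero, zero_smul, Pi.zero_apply],
    realTrigPoly_zero, Pi.zero_apply]

/-- `∂₂ g = 0`. [folklore] -/
theorem partialDeriv_one_kolSin (y : UnitAddTorus (Fin 3)) : partialDeriv 1 kolSin y = 0 := by
  rw [kolSin, partialDeriv_realTrigPoly,
    realTrigPoly_congr (c' := 0) fun k hk => by
      rw [apply_one_of_mem_kolModes hk, Int.cast_zero, mul_zero, zero_smul, Pi.zero_apply],
    realTrigPoly_zero, Pi.zero_apply]

/-- `∂₃ g = 2π f`. [folklore] -/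
theorem partialDeriv_two_kolSin (y : UnitAddTorus (Fin 3)) :
    partialDeriv 2 kolSin y = (2 * Real.pi) • kolForce y := by
  rw [kolSin, partialDeriv_realTrigPoly, kolForce, smul_realTrigPoly_apply]
  exact congrFun (realTrigPoly_congr fun k hk => by
    rw [Pi.smul_apply, kolForceCoeff_of_ne_zero (ne_zero_of_mem_kolModes hk), kolSinCoeff,
      smul_smul, ← Complex.coe_smul]
    congr 1
    rw [show 2 * (Real.pi : ℂ) * Complex.I * ((k 2 : ℤ) : ℂ) * -(Complex.I * ((k 2 : ℤ) : ℂ)) =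
        -(Complex.I ^ 2) * (2 * Real.pi) * ((k 2 : ℤ) : ℂ) ^ 2 by ring,
      Complex.I_sq, sq_apply_two_of_mem_kolModes_complex hk]
    push_cast
    ring) y

/-- `∂₁ f = 0`. [folklore] -/
theorem partialDeriv_zero_kolForce (y : UnitAddTorus (Fin 3)) : partialDeriv 0 kolForce y = 0 := by
  rw [kolForce, partialDeriv_realTrigPoly,
    realTrigPoly_congr (c' := 0) fun k hk => by
      rw [apply_zero_of_mem_kolModes hk, Int.cast_zero, mul_zero, zero_smul, Pi.zero_apply],
    realTrigPoly_zero, Pi.zero_apply]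

/-- `∂₂ f = 0`. [folklore] -/
theorem partialDeriv_one_kolForce (y : UnitAddTorus (Fin 3)) : partialDeriv 1 kolForce y = 0 := by
  rw [kolForce, partialDeriv_realTrigPoly,
    realTrigPoly_congr (c' := 0) fun k hk => by
      rw [apply_one_of_mem_kolModes hk, Int.cast_zero, mul_zero, zero_smul, Pi.zero_apply],
    realTrigPoly_zero, Pi.zero_apply]

/-- `∂₃ f = −2π g`. [folklore] -/
theorem partialDeriv_two_kolForce (y : UnitAddTorus (Fin 3)) :
    partialDeriv 2 kolForce y = (-(2 * Real.pi)) • kolSin y := by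
  rw [kolForce, partialDeriv_realTrigPoly, kolSin, smul_realTrigPoly_apply]
  exact congrFun (realTrigPoly_congr fun k hk => by
    rw [Pi.smul_apply, kolForceCoeff_of_ne_zero (ne_zero_of_mem_kolModes hk), kolSinCoeff,
      ← Complex.coe_smul, smul_smul]
    congr 1
    push_cast
    ring) y

/-- Advection of `g` by any `C¹` field: `(U·∇)g = 2π U₃ f`. [folklore] -/
theorem convect_kolSin (U : UnitAddTorus (Fin 3) → EuclideanSpace ℝ (Fin 3))
    (y : UnitAddTorus (Fin 3)) :
    Torus.convect U kolSin y = (2 * Real.pi * U y 2) • kolForce y := by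
  have h1 : IsContDiff 1 kolSin := isSmooth_kolSin.isContDiff (by simp)
  rw [Torus.convect, fderiv_apply_eq_sum_partialDeriv h1, Fin.sum_univ_three,
    partialDeriv_zero_kolSin, partialDeriv_one_kolSin, partialDeriv_two_kolSin, smul_zero,
    smul_zero, zero_add, zero_add, smul_smul, mul_comm]

/-- Advection of `f` by any `C¹` field: `(U·∇)f = −2π U₃ g`. [folklore] -/
theorem convect_kolForce (U : UnitAddTorus (Fin 3) → EuclideanSpace ℝ (Fin 3))
    (y : UnitAddTorus (Fin 3)) :
    Torus.convect U kolForce y = (-(2 * Real.pi * U y 2)) • kolSin y := by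
  have h1 : IsContDiff 1 kolForce := isSmooth_kolForce.isContDiff (by simp)
  rw [Torus.convect, fderiv_apply_eq_sum_partialDeriv h1, Fin.sum_univ_three,
    partialDeriv_zero_kolForce, partialDeriv_one_kolForce, partialDeriv_two_kolForce, smul_zero,
    smul_zero, zero_add, zero_add, smul_smul]
  congr 1
  ring

/-- `f ⊥ g` in `L²`. [folklore] -/
theorem integral_inner_kolForce_kolSin : ∫ x, ⟪kolForce x, kolSin x⟫_ℝ = 0 := by
  rw [kolForce, kolSin, integral_inner_realTrigPoly_realTrigPoly kolModes_symm
    isConjSymm_kolForceCoeff isConjSymm_kolSinCoeff]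
  refine Finset.sum_eq_zero fun k hk => ?_
  rw [kolForceCoeff_of_ne_zero (ne_zero_of_mem_kolModes hk), kolSinCoeff, inner_smul_right,
    inner_kolVec_self]
  simp [Complex.mul_re]

/-- `∫ ⟪f, f⟫ = ½`. [folklore] -/
theorem integral_inner_kolForce_self : ∫ x, ⟪kolForce x, kolForce x⟫_ℝ = 1 / 2 := by
  simp_rw [real_inner_self_eq_norm_sq]
  exact integral_norm_sq_kolForce

/-- `∫⟪U, (U·∇)g⟫ = 2π ∫ U₃ ⟪f, U⟫` for any field `U`. [folklore] -/
theorem integral_inner_convect_kolSin (U : UnitAddTorus (Fin 3) → EuclideanSpace ℝ (Fin 3)) :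
    ∫ x, ⟪U x, Torus.convect U kolSin x⟫_ℝ = 2 * Real.pi * ∫ x, U x 2 * ⟪kolForce x, U x⟫_ℝ := by
  rw [← integral_const_mul]
  refine integral_congr_ae (ae_of_all _ fun x => ?_)
  dsimp only
  rw [convect_kolSin, real_inner_smul_right, real_inner_comm]
  ring

/-- `∫⟪U, Δg⟫ = −4π² ∫ ⟪g, U⟫` for any field `U`. [folklore] -/
theorem integral_inner_laplacian_kolSin (U : UnitAddTorus (Fin 3) → EuclideanSpace ℝ (Fin 3)) :
    ∫ x, ⟪U x, Torus.laplacian kolSin x⟫_ℝ = -(4 * Real.pi ^ 2) * ∫ x, ⟪kolSin x, U x⟫_ℝ := by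
  rw [← integral_const_mul]
  refine integral_congr_ae (ae_of_all _ fun x => ?_)
  dsimp only
  rw [laplacian_kolSin, real_inner_smul_right, real_inner_comm]

/-- `∫⟪U, (U·∇)f⟫ = −2π ∫ U₃ ⟪g, U⟫` for any field `U`. [folklore] -/
theorem integral_inner_convect_kolForce (U : UnitAddTorus (Fin 3) → EuclideanSpace ℝ (Fin 3)) :
    ∫ x, ⟪U x, Torus.convect U kolForce x⟫_ℝ =
      -(2 * Real.pi) * ∫ x, U x 2 * ⟪kolSin x, U x⟫_ℝ := by
  rw [← integral_const_mul]
  refine integral_congr_ae (ae_of_all _ fun x => ?_)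
  dsimp only
  rw [convect_kolForce, real_inner_smul_right, real_inner_comm]
  ring

/-- `∫⟪U, Δf⟫ = −4π² ∫ ⟪f, U⟫` for any field `U`. [folklore] -/
theorem integral_inner_laplacian_kolForce (U : UnitAddTorus (Fin 3) → EuclideanSpace ℝ (Fin 3)) :
    ∫ x, ⟪U x, Torus.laplacian kolForce x⟫_ℝ = -(4 * Real.pi ^ 2) * ∫ x, ⟪kolForce x, U x⟫_ℝ := by
  rw [← integral_const_mul]
  refine integral_congr_ae (ae_of_all _ fun x => ?_)
  dsimp only
  rw [laplacian_kolForce, real_inner_smul_right, real_inner_comm]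

/-! ### The two flux-moment identities -/

/-- Smooth real functions on `𝕋³` are integrable. [folklore] -/
theorem integrable_of_isSmooth_real {g : UnitAddTorus (Fin 3) → ℝ} (hg : IsSmooth g) :
    Integrable g volume :=
  hg.continuous.integrable_of_hasCompactSupport (HasCompactSupport.of_compactSpace g)

/-- **Quadrature flux identity.** For every smooth steady state of the Kolmogorov-forced
Navier–Stokes system at viscosity `ν` (any momentum): `∫ U₃ ⟪f, U⟫ = 2πν ∫ ⟪g, U⟫`
(test the steady equation with `g = sin(2πx₃)e₁`: `⟪f, g⟫ = 0`, `(U·∇)g = 2πU₃ f`,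
`Δg = −4π²g`, antisymmetry of the trilinear form). [folklore; cite: Temam1984, Ch. II Lemma 1.3] -/
theorem flux_quadrature_identity {ν : ℝ} {U : UnitAddTorus (Fin 3) → EuclideanSpace ℝ (Fin 3)}
    {P : UnitAddTorus (Fin 3) → ℝ} (h : Torus.IsSteadyNSState ν kolForce U P) :
    ∫ x, U x 2 * ⟪kolForce x, U x⟫_ℝ = 2 * Real.pi * ν * ∫ x, ⟪kolSin x, U x⟫_ℝ := by
  have hU : Torus.IsSmooth U :=
    (Torus.IsClassicalNSSolutionOn.smooth_velocity h).isSmooth_slice (mem_univ (0 : ℝ))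
  have hUd : Torus.IsDivFree U := Torus.IsClassicalNSSolutionOn.divFree h 0 (mem_univ (0 : ℝ))
  have hw := work_on_test_field h isSmooth_kolSin isDivFree_kolSin
  rw [integral_inner_kolForce_kolSin,
    Torus.integral_inner_convect_eq_neg hU hUd hU isSmooth_kolSin, integral_inner_convect_kolSin,
    integral_inner_laplacian_kolSin] at hw
  have h3 : (2 * Real.pi) * ∫ x, U x 2 * ⟪kolForce x, U x⟫_ℝ =
      (2 * Real.pi) * (2 * Real.pi * ν * ∫ x, ⟪kolSin x, U x⟫_ℝ) := by
    linear_combination hw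
  exact mul_left_cancel₀ (by positivity) h3

/-- **In-phase flux identity (stress pinning).** For every smooth steady state of the
Kolmogorov-forced system at viscosity `ν` (any momentum):
`2π ∫ U₃ ⟪g, U⟫ = ½ − 4π²ν ∫ ⟪f, U⟫` (test with `f` itself: `⟪f, f⟫` integrates to `½`,
`(U·∇)f = −2πU₃ g`, `Δf = −4π²f`). [folklore; cite: Temam1984, Ch. II Lemma 1.3] -/
theorem flux_inphase_identity {ν : ℝ} {U : UnitAddTorus (Fin 3) → EuclideanSpace ℝ (Fin 3)}
    {P : UnitAddTorus (Fin 3) → ℝ} (h : Torus.IsSteadyNSState ν kolForce U P) :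
    2 * Real.pi * ∫ x, U x 2 * ⟪kolSin x, U x⟫_ℝ =
      1 / 2 - 4 * Real.pi ^ 2 * ν * ∫ x, ⟪kolForce x, U x⟫_ℝ := by
  have hU : Torus.IsSmooth U :=
    (Torus.IsClassicalNSSolutionOn.smooth_velocity h).isSmooth_slice (mem_univ (0 : ℝ))
  have hUd : Torus.IsDivFree U := Torus.IsClassicalNSSolutionOn.divFree h 0 (mem_univ (0 : ℝ))
  have hw := work_on_test_field h isSmooth_kolForce isDivFree_kolForce
  rw [integral_inner_kolForce_self,
    Torus.integral_inner_convect_eq_neg hU hUd hU isSmooth_kolForce,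
    integral_inner_convect_kolForce, integral_inner_laplacian_kolForce] at hw
  linear_combination -hw

/-! ### The work formula -/

/-- Splitting a fluctuation moment: `∫ (U₃ − m₃) G = ∫ U₃ G − m₃ ∫ G` for smooth `U`, `G`.
[folklore] -/
theorem integral_fluct_mul {U : UnitAddTorus (Fin 3) → EuclideanSpace ℝ (Fin 3)}
    {G : UnitAddTorus (Fin 3) → ℝ} (hU : IsSmooth U) (hG : IsSmooth G) (m : ℝ) :
    ∫ x, (U x 2 - m) * G x = (∫ x, U x 2 * G x) - m * ∫ x, G x := by
  have i1 : Integrable (fun x => U x 2 * G x) volume :=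
    integrable_of_isSmooth_real ((hU.apply 2).mul hG)
  have i2 : Integrable (fun x => m * G x) volume := (integrable_of_isSmooth_real hG).const_mul m
  simp_rw [sub_mul]
  rw [integral_sub i1 i2, integral_const_mul]

/-- **Work formula.** For every smooth steady state `(U, P)` of the Kolmogorov-forced
Navier–Stokes system at viscosity `ν`, with cross-layer momentum `m₃ = ∫ U₃`, power
`W = ∫⟪f, U⟫` and fluctuation flux moments `Φ_s = ∫ (U₃ − m₃)⟪g, U⟫`, `Φ_c = ∫ (U₃ − m₃)⟪f, U⟫`:

  `W · (m₃² + 4π²ν²) = ν/2 − 2πν Φ_s − m₃ Φ_c`.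

With `Φ_s = Φ_c = 0` this is the drifted laminar law; at `m₃ = 0` it reads
`4π²ν W = ½ − 2πΦ_s`; at `m₃ ≠ 0`, `W = −Φ_c/m₃ + O(ν)`. [folklore] -/
theorem work_formula {ν : ℝ} {U : UnitAddTorus (Fin 3) → EuclideanSpace ℝ (Fin 3)}
    {P : UnitAddTorus (Fin 3) → ℝ} (h : Torus.IsSteadyNSState ν kolForce U P) :
    (∫ x, ⟪kolForce x, U x⟫_ℝ) * ((∫ x, U x 2) ^ 2 + 4 * Real.pi ^ 2 * ν ^ 2) =
      ν / 2 - 2 * Real.pi * ν * (∫ x, (U x 2 - ∫ y, U y 2) * ⟪kolSin x, U x⟫_ℝ)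
        - (∫ x, U x 2) * ∫ x, (U x 2 - ∫ y, U y 2) * ⟪kolForce x, U x⟫_ℝ := by
  have hU : Torus.IsSmooth U :=
    (Torus.IsClassicalNSSolutionOn.smooth_velocity h).isSmooth_slice (mem_univ (0 : ℝ))
  have hq := flux_quadrature_identity h
  have hp := flux_inphase_identity h
  rw [integral_fluct_mul hU (isSmooth_kolSin.inner hU),
    integral_fluct_mul hU (isSmooth_kolForce.inner hU)]
  linear_combination ν * hp + (∫ x, U x 2) * hq

/-- **Work formula, dissipation form**: the same identity with `W = ν ∫‖∇U‖²`
(`steady_work_identity`). [folklore] -/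
theorem dissipation_formula {ν : ℝ} {U : UnitAddTorus (Fin 3) → EuclideanSpace ℝ (Fin 3)}
    {P : UnitAddTorus (Fin 3) → ℝ} (h : Torus.IsSteadyNSState ν kolForce U P) :
    ν * Torus.gradNormSq U * ((∫ x, U x 2) ^ 2 + 4 * Real.pi ^ 2 * ν ^ 2) =
      ν / 2 - 2 * Real.pi * ν * (∫ x, (U x 2 - ∫ y, U y 2) * ⟪kolSin x, U x⟫_ℝ)
        - (∫ x, U x 2) * ∫ x, (U x 2 - ∫ y, U y 2) * ⟪kolForce x, U x⟫_ℝ := by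
  rw [steady_work_identity h]
  exact work_formula h

/-- **Zero-momentum reading.** At `m₃ = ∫ U₃ = 0` the fluctuation fluxes of `work_formula` are
the full moments, the power is slaved to the in-phase fluctuation flux, `4π²ν W = ½ − 2π Φ_s`
(so `W ≍ 1` along `ν → 0` iff `Φ_s → 1/(4π)` with defect exactly `2πν W`), and the quadrature
fluctuation flux is `O(ν)`: `Φ_c = 2πν ∫⟪g, U⟫`. [folklore] -/
theorem zero_momentum_reading {ν : ℝ} {U : UnitAddTorus (Fin 3) → EuclideanSpace ℝ (Fin 3)}
    {P : UnitAddTorus (Fin 3) → ℝ} (h : Torus.IsSteadyNSState ν kolForce U P)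
    (h0 : ∫ x, U x 2 = 0) :
    4 * Real.pi ^ 2 * ν * (∫ x, ⟪kolForce x, U x⟫_ℝ) =
        1 / 2 - 2 * Real.pi * ∫ x, (U x 2 - ∫ y, U y 2) * ⟪kolSin x, U x⟫_ℝ ∧
      ∫ x, (U x 2 - ∫ y, U y 2) * ⟪kolForce x, U x⟫_ℝ =
        2 * Real.pi * ν * ∫ x, ⟪kolSin x, U x⟫_ℝ := by
  simp only [h0, sub_zero]
  exact ⟨by linear_combination flux_inphase_identity h, flux_quadrature_identity h⟩

/-- **Nonzero-momentum reading.** At momentum `m₃ = ∫ U₃ ≠ 0`: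
`W = (ν/2 − 2πν Φ_s − m₃ Φ_c)/(m₃² + 4π²ν²)`; in particular a power floor `ε ≤ W` along `ν → 0`
at fixed `m₃ ≠ 0` forces the quadrature fluctuation flux `Φ_c → −m₃ W ≠ 0`, whereas it vanishes
identically for the drifted laminar states. [folklore] -/
theorem nonzero_momentum_reading {ν : ℝ} {U : UnitAddTorus (Fin 3) → EuclideanSpace ℝ (Fin 3)}
    {P : UnitAddTorus (Fin 3) → ℝ} (h : Torus.IsSteadyNSState ν kolForce U P)
    (hm : (∫ x, U x 2) ≠ 0 ∨ ν ≠ 0) :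
    ∫ x, ⟪kolForce x, U x⟫_ℝ =
      (ν / 2 - 2 * Real.pi * ν * (∫ x, (U x 2 - ∫ y, U y 2) * ⟪kolSin x, U x⟫_ℝ)
        - (∫ x, U x 2) * ∫ x, (U x 2 - ∫ y, U y 2) * ⟪kolForce x, U x⟫_ℝ) /
        ((∫ x, U x 2) ^ 2 + 4 * Real.pi ^ 2 * ν ^ 2) := by
  have hD : (∫ x, U x 2) ^ 2 + 4 * Real.pi ^ 2 * ν ^ 2 ≠ 0 := by
    rcases hm with hm | hν
    · have : 0 < (∫ x, U x 2) ^ 2 := by positivity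
      positivity
    · have : 0 < ν ^ 2 := by positivity
      positivity
  rw [eq_div_iff hD]
  exact work_formula h

end Summit.AnomalousDissipation.AnomalousDissipation.Theorems

end
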